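import Literature.Probability.RandomPlanarGeometry.SAWMultiSurgery
import HarnessLib

/-!
# Self-avoiding walk on `ℤ^{d+2}`: the counting step of Kesten's pattern theorem

Continuation of `SAWMultiSurgery.lean`. We formalise the counting argument of the proof of
Kesten's pattern theorem as printed in N. Madras, G. Slade, *The Self-Avoiding Walk* (1993),
§7.2, proof of Lemma 7.2.6, (7.2.19)–(7.2.21) (and re-used verbatim in the proof of
Theorem 7.2.3): to each pair (`ω`, `J`) — a self-avoiding walk of length `N` and a set of `s`
well separated surgery sites of `ω` — one associates the modified walk `Φ(ω, J)` (the route of a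
`RouteProvider` spliced into each of the `s` cubes); "given the resulting walk, the locations of
the cubes and the pieces removed, `ω` is determined", and the locations of the cubes are read off
a set of `s` *marker times* of the modified walk, which the applications confine to a set of at
most `B₀` recognisable times. Hence (`sum_choose_le_of_codes`)

  `Σ_{ω ∈ T} C(|M ω|, s) ≤ (Σ_{n ≤ N + Λ s} c_n) · C(B₀, s) · ((2R+1)^{d+2})^s · (2m+1)^s · (Σ_{n ≤ 2m} c_n)^s`,

the abstract form of the displayed inequality "(number of walks in `T`) × (number of choices of
`J`) ≤ (number of resulting walks) × (number of possible data)" from which both Lemma 7.2.6 and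
Theorem 7.2.3 are concluded by taking `N`-th roots.

## Contents (namespace `Literature.Probability.RandomPlanarGeometry.SAW.Zd`)

* exact bookkeeping for the multi-site operation `Phi` of `SAWMultiSurgery`: total site data
  `fvis`, `lenAt`, `routeAt`; `op_trichotomy`; `site_data_op'`; `Phi_blocks'`;
  `Phi_suffix_exact` (a late time `t` becomes exactly `t + |Φ| - N`); `Phi_points` (every time of
  the final walk is a surviving old time or a route time); `Phi_ball` (the points of the final
  walk in the cube of a site are points of its route); `Phi_order` (the cubes are traversed in
  the order of the sites);
* `MarkedRouteProvider` (a route provider with a marker time on each route), `ValidSet`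
  (finite-set version of `Valid`), `sitesOf`, `PhiJ`, the marker times `mtimeOf` of the sites on
  the final walk and their monotonicity `mtimeOf_lt`, `mtimes`, `sort_mtimes`;
* the code `cubeCode ρ N s ω J` = (final walk, set of marker times, and per site: offset of the
  marker point, length of the removed piece, removed piece `pieceAt`), its left inverse `recon`
  (`recon_cubeCode`, via `Decode_congr`, `dataList_approx` and `Decode_Phi`) and `cubeCode_inj`;
* the target set `codeTarget` with its cardinality `card_codeTarget`, `cubeCode_mem_codeTarget`, and
  the counting inequality **`sum_choose_le_of_codes`**.

Everything is proved; no named facts.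
-/

noncomputable section

open Filter Topology Literature.Probability.LatticeModels Literature.Probability.Percolation SimpleGraph
open scoped BigOperators

namespace Literature.Probability.RandomPlanarGeometry.SAW.Zd

/-! ### Exact bookkeeping: total site data, trichotomy, surviving points, order of the cubes -/

section Exact

variable {d : ℕ} {R : ℤ} {Λ m : ℕ} (ρ : RouteProvider d R Λ)

open Classical in
/-- Total version of the first visit of `ω` to the cube of its site `l` (junk `0` if there is
no visit, which does not happen: `ω l` itself is in the cube when `0 ≤ R`). [folklore] -/
def fvis (R : ℤ) (ω : ℕ → Site (d + 2)) (l : ℕ) : ℕ :=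
  if h : ∃ t, InBall R (ω l) (ω t) then firstVisit R (ω l) ω h else 0

/-- The length of the route spliced in at the site `l` of `(N, ω)`. [folklore] -/
def lenAt (N : ℕ) (ω : ℕ → Site (d + 2)) (l : ℕ) : ℕ :=
  ρ.len (ω l) (ω (fvis R ω l)) (ω (lastVisit R (ω l) ω N))

/-- The route spliced in at the site `l` of `(N, ω)`. [folklore] -/
def routeAt (N : ℕ) (ω : ℕ → Site (d + 2)) (l : ℕ) : ℕ → Site (d + 2) :=
  ρ.path (ω l) (ω (fvis R ω l)) (ω (lastVisit R (ω l) ω N))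

variable {ρ} {N : ℕ} {ω : ℕ → Site (d + 2)} {j : ℕ}

/-- `fvis` is the first visit when there is a visit. [folklore] -/
theorem fvis_eq {l : ℕ} (h : ∃ t, InBall R (ω l) (ω t)) : fvis R ω l = firstVisit R (ω l) ω h := dif_pos h

/-- The windows of the first and last visits at a surgery site. [folklore] -/
theorem fvis_spec (h : SurgerySite ω N R j (j - m) (j + m)) :
    j - m ≤ fvis R ω j ∧ fvis R ω j ≤ j ∧ j ≤ lastVisit R (ω j) ω N ∧ lastVisit R (ω j) ω N ≤ j + m ∧
      fvis R ω j < lastVisit R (ω j) ω N ∧ lastVisit R (ω j) ω N ≤ N := by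
  rw [fvis_eq h.exists_visit]
  exact ⟨h.first_spec.1, h.first_spec.2, h.last_spec.1, h.last_spec.2, h.first_lt_last, lastVisit_le⟩

/-- `op` in terms of the total site data. [folklore] -/
theorem op_eq' (h : SurgerySite ω N R j (j - m) (j + m)) :
    op ρ (N, ω) j = (fvis R ω j + lenAt ρ N ω j + (N - lastVisit R (ω j) ω N),
      splice ω (fvis R ω j) (lastVisit R (ω j) ω N) (lenAt ρ N ω j) (routeAt ρ N ω j)) := by
  rw [op_eq ρ h, lenAt, routeAt, fvis_eq h.exists_visit]

/-- The route at a surgery site: length bound, endpoints, self-avoidance, inside the cube. [folklore] -/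
theorem routeAt_spec (ρ : RouteProvider d R Λ) (h : SurgerySite ω N R j (j - m) (j + m)) :
    lenAt ρ N ω j ≤ Λ ∧ routeAt ρ N ω j 0 = ω (fvis R ω j) ∧
    routeAt ρ N ω j (lenAt ρ N ω j) = ω (lastVisit R (ω j) ω N) ∧ PathOn (lenAt ρ N ω j) (routeAt ρ N ω j) ∧
    ∀ t ≤ lenAt ρ N ω j, InBall R (ω j) (routeAt ρ N ω j t) := by
  have := route_spec ρ h
  rw [lenAt, routeAt, fvis_eq h.exists_visit]
  exact this

/-- **Trichotomy of the times of the operated walk**: before the route (unchanged), on the route,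
after the route (a shifted old time `≥ τ`, capped at `N`). [folklore] -/
theorem op_trichotomy (ρ : RouteProvider d R Λ) (h : SurgerySite ω N R j (j - m) (j + m)) (t : ℕ) :
    (t ≤ fvis R ω j ∧ (op ρ (N, ω) j).2 t = ω t) ∨
    (∃ u ≤ lenAt ρ N ω j, t = fvis R ω j + u ∧ (op ρ (N, ω) j).2 t = routeAt ρ N ω j u) ∨
    (∃ t', lastVisit R (ω j) ω N ≤ t' ∧ t' ≤ N ∧ fvis R ω j + lenAt ρ N ω j ≤ t ∧ (op ρ (N, ω) j).2 t = ω t') := by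
  obtain ⟨-, h0, hend, -, -⟩ := routeAt_spec ρ h
  obtain ⟨-, -, -, -, -, h6⟩ := fvis_spec h
  rw [op_eq' h]
  simp only
  rcases le_or_gt t (fvis R ω j) with ht | ht
  · exact Or.inl ⟨ht, splice_of_le ht⟩
  · rcases le_or_gt t (fvis R ω j + lenAt ρ N ω j) with ht' | ht'
    · obtain ⟨u, rfl⟩ : ∃ u, t = fvis R ω j + u := ⟨t - fvis R ω j, by omega⟩
      exact Or.inr (Or.inl ⟨u, by omega, rfl, splice_piece h0 (by omega)⟩)
    · obtain ⟨u, rfl⟩ : ∃ u, t = fvis R ω j + lenAt ρ N ω j + u :=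
        ⟨t - fvis R ω j - lenAt ρ N ω j, by omega⟩
      refine Or.inr (Or.inr ?_)
      rw [splice_after h0 hend]
      rcases le_or_gt (lastVisit R (ω j) ω N + u) N with hu | hu
      · exact ⟨_, by omega, hu, by omega, rfl⟩
      · exact ⟨N, h6, le_rfl, by omega, (mem_saws.1 h.mem).2.1 _ hu.le⟩

/-- Site data (total form) are unchanged by an operation at a later, far-away site. [folklore] -/
theorem site_data_op' (hj : SurgerySite ω N R j (j - m) (j + m)) {l : ℕ}
    (hl : SurgerySite ω N R l (l - m) (l + m)) (hlj : l + 2 * m + 1 ≤ j) (hap : ∃ k, 2 * R < |ω j k - ω l k|) :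
    (op ρ (N, ω) j).2 l = ω l ∧ fvis R (op ρ (N, ω) j).2 l = fvis R ω l ∧
    lastVisit R ((op ρ (N, ω) j).2 l) (op ρ (N, ω) j).2 (op ρ (N, ω) j).1 = lastVisit R (ω l) ω N ∧
    lenAt ρ (op ρ (N, ω) j).1 (op ρ (N, ω) j).2 l = lenAt ρ N ω l ∧
    routeAt ρ (op ρ (N, ω) j).1 (op ρ (N, ω) j).2 l = routeAt ρ N ω l := by
  obtain ⟨hll, hfirst, hlast, hσe, hτe⟩ := site_data_op ρ hj hl hlj hap
  have hl' := op_preserves ρ hj hl hlj hap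
  have hf : fvis R (op ρ (N, ω) j).2 l = fvis R ω l := by
    rw [fvis_eq hl'.exists_visit, fvis_eq hl.exists_visit]; exact hfirst
  have hσe' : (op ρ (N, ω) j).2 (fvis R ω l) = ω (fvis R ω l) := by
    rw [fvis_eq hl.exists_visit]; exact hσe
  refine ⟨hll, hf, hlast, ?_, ?_⟩
  · unfold lenAt
    rw [hf, hlast, hll, hσe', hτe]
  · unfold routeAt
    rw [hf, hlast, hll, hσe', hτe]

/-- `Phi_blocks` in terms of the total site data. [cite: MadrasSlade1993, Lemma 7.2.6 (proof)] -/
theorem Phi_blocks' {js : List ℕ} (hv : Valid m R N ω js) {l : ℕ} (hl : l ∈ js) :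
    ∃ t₀, t₀ + lenAt ρ N ω l ≤ (Phi ρ (N, ω) js).1 ∧
      ∀ s ≤ lenAt ρ N ω l, (Phi ρ (N, ω) js).2 (t₀ + s) = routeAt ρ N ω l s := by
  have := Phi_blocks ρ js hv l hl
  rwa [lenAt, routeAt, fvis_eq (hv.site l hl).exists_visit]

/-- **Exact suffix shift**: a time `t ≥ T` beyond all windows becomes the time `t + |Φ| - N` of
the final walk (with `N ≤ t + |Φ|`), with the same value. [folklore] -/
theorem Phi_suffix_exact : ∀ (js : List ℕ) {N : ℕ} {ω : ℕ → Site (d + 2)}, Valid m R N ω js →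
    ∀ T, (∀ l ∈ js, l + m + 1 ≤ T) → ∀ t, T ≤ t → t ≤ N →
      N ≤ t + (Phi ρ (N, ω) js).1 ∧ t + (Phi ρ (N, ω) js).1 - N ≤ (Phi ρ (N, ω) js).1 ∧
        (Phi ρ (N, ω) js).2 (t + (Phi ρ (N, ω) js).1 - N) = ω t
  | [], N, ω, _, T, _, t, _, ht => ⟨by simp [Phi], by simp [Phi]; omega, by simp [Phi]⟩
  | j :: rest, N, ω, hv, T, hT, t, hTt, htN => by
    have hj := hv.site j (by simp)
    obtain ⟨h1, h2, h3, h4, h5, h6⟩ := fvis_spec hj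
    have hTj : j + m + 1 ≤ T := hT j (by simp)
    have hop1 : (op ρ (N, ω) j).1 = fvis R ω j + lenAt ρ N ω j + (N - lastVisit R (ω j) ω N) := by
      rw [op_eq' hj]
    obtain ⟨u, rfl⟩ : ∃ u, t = lastVisit R (ω j) ω N + u := ⟨t - lastVisit R (ω j) ω N, by omega⟩
    have hafter : (op ρ (N, ω) j).2 (fvis R ω j + lenAt ρ N ω j + u) = ω (lastVisit R (ω j) ω N + u) := by
      obtain ⟨-, h0, hend, -, -⟩ := routeAt_spec ρ hj
      rw [op_eq' hj]
      exact splice_after h0 hend u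
    obtain ⟨k1, k2, k3⟩ := Phi_suffix_exact rest (hv.op_cons (ρ := ρ)) (fvis R ω j + lenAt ρ N ω j + (T - lastVisit R (ω j) ω N))
      (fun l hl => by have := (List.pairwise_cons.1 hv.gaps).1 l hl; omega)
      (fvis R ω j + lenAt ρ N ω j + u) (by omega) (by rw [hop1]; omega)
    have epair : ((op ρ (N, ω) j).1, (op ρ (N, ω) j).2) = op ρ (N, ω) j := Prod.mk.eta
    rw [epair] at k1 k2 k3
    rw [hop1] at k1 k2 k3
    simp only [Phi]
    refine ⟨by omega, by omega, ?_⟩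
    rw [show lastVisit R (ω j) ω N + u + (Phi ρ (op ρ (N, ω) j) rest).1 - N =
      fvis R ω j + lenAt ρ N ω j + u + (Phi ρ (op ρ (N, ω) j) rest).1 -
        (fvis R ω j + lenAt ρ N ω j + (N - lastVisit R (ω j) ω N)) by omega, k3, hafter]

/-- **Every time of the final walk is a surviving old time or a route time**: its value is
`ω t` for a time `t ≤ N` outside all the open intervals `(σ_l, τ_l)`, or a point of one of the
routes. [cite: MadrasSlade1993, Lemma 7.2.6 (proof)] -/
theorem Phi_points : ∀ (js : List ℕ) {N : ℕ} {ω : ℕ → Site (d + 2)}, Valid m R N ω js → ∀ i,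
    (∃ t ≤ N, (∀ l ∈ js, t ≤ fvis R ω l ∨ lastVisit R (ω l) ω N ≤ t) ∧ (Phi ρ (N, ω) js).2 i = ω t) ∨
      ∃ l ∈ js, ∃ u ≤ lenAt ρ N ω l, (Phi ρ (N, ω) js).2 i = routeAt ρ N ω l u
  | [], N, ω, hv, i => by
    refine Or.inl ?_
    rcases le_or_gt i N with h | h
    · exact ⟨i, h, fun l hl => by simp at hl, rfl⟩
    · exact ⟨N, le_rfl, fun l hl => by simp at hl, (mem_saws.1 hv.mem).2.1 i h.le⟩
  | j :: rest, N, ω, hv, i => by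
    have hj := hv.site j (by simp)
    obtain ⟨h1, h2, h3, h4, h5, h6⟩ := fvis_spec hj
    have hgaps := List.pairwise_cons.1 hv.gaps
    have haps := List.pairwise_cons.1 hv.apart
    have hdata : ∀ l ∈ rest, (op ρ (N, ω) j).2 l = ω l ∧ fvis R (op ρ (N, ω) j).2 l = fvis R ω l ∧
        lastVisit R ((op ρ (N, ω) j).2 l) (op ρ (N, ω) j).2 (op ρ (N, ω) j).1 = lastVisit R (ω l) ω N ∧
        lenAt ρ (op ρ (N, ω) j).1 (op ρ (N, ω) j).2 l = lenAt ρ N ω l ∧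
        routeAt ρ (op ρ (N, ω) j).1 (op ρ (N, ω) j).2 l = routeAt ρ N ω l := fun l hl =>
      site_data_op' hj (hv.site l (by simp [hl])) (hgaps.1 l hl) (haps.1 l hl)
    have hwin : ∀ l ∈ rest, lastVisit R (ω l) ω N < j - m := fun l hl => by
      have := (fvis_spec (hv.site l (by simp [hl]))).2.2.2.1
      have := hgaps.1 l hl
      omega
    have epair : ((op ρ (N, ω) j).1, (op ρ (N, ω) j).2) = op ρ (N, ω) j := Prod.mk.eta
    simp only [Phi]
    rcases Phi_points rest (hv.op_cons (ρ := ρ)) i with ⟨t, htN, hsurv, e⟩ | ⟨l, hl, u, hu, e⟩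
    · rw [epair] at e
      rcases op_trichotomy ρ hj t with ⟨ht, e'⟩ | ⟨u, hu, rfl, e'⟩ | ⟨t', h1', h2', h3', e'⟩
      · refine Or.inl ⟨t, by omega, fun l hl => ?_, by rw [e, e']⟩
        rcases List.mem_cons.1 hl with rfl | hl
        · exact Or.inl ht
        · obtain ⟨-, hf, hla, -, -⟩ := hdata l hl
          have := hsurv l hl
          rwa [hf, hla] at this
      · exact Or.inr ⟨j, by simp, u, hu, by rw [e, e']⟩
      · refine Or.inl ⟨t', h2', fun l hl => ?_, by rw [e, e']⟩
        rcases List.mem_cons.1 hl with rfl | hl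
        · exact Or.inr h1'
        · exact Or.inr (by have := hwin l hl; omega)
    · rw [epair] at e
      obtain ⟨-, -, -, hlen, hroute⟩ := hdata l hl
      exact Or.inr ⟨l, by simp [hl], u, by rwa [hlen] at hu, by rw [e, hroute]⟩

/-- The "apart" relation is symmetric. [folklore] -/
theorem apart_symm {a b : Site (d + 2)} (h : ∃ k, 2 * R < |a k - b k|) : ∃ k, 2 * R < |b k - a k| := by
  obtain ⟨k, hk⟩ := h; exact ⟨k, by rwa [abs_sub_comm]⟩

/-- Two distinct listed sites of a valid list have cubes apart. [folklore] -/
theorem Valid.apart_of_ne {js : List ℕ} (hv : Valid m R N ω js) {a b : ℕ} (ha : a ∈ js) (hb : b ∈ js)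
    (hab : a ≠ b) : ∃ k, 2 * R < |ω a k - ω b k| :=
  have : Std.Symm (fun a b : ℕ => ∃ k, 2 * R < |ω a k - ω b k|) := ⟨fun _ _ h => apart_symm h⟩
  hv.apart.forall ha hb hab

/-- **The points of the final walk inside the cube of a listed site are points of its route.**
[cite: MadrasSlade1993, Lemma 7.2.6 (proof)] -/
theorem Phi_ball {js : List ℕ} (hv : Valid m R N ω js) {l : ℕ} (hl : l ∈ js) {i : ℕ}
    (hin : InBall R (ω l) ((Phi ρ (N, ω) js).2 i)) :
    ∃ u ≤ lenAt ρ N ω l, (Phi ρ (N, ω) js).2 i = routeAt ρ N ω l u := by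
  have hls := hv.site l hl
  obtain ⟨-, h0, hend, -, -⟩ := routeAt_spec ρ hls
  rcases Phi_points (ρ := ρ) js hv i with ⟨t, htN, hsurv, e⟩ | ⟨l', hl', u, hu, e⟩
  · rw [e] at hin
    have hσt : fvis R ω l ≤ t := by
      rw [fvis_eq hls.exists_visit]
      by_contra hlt
      exact not_inBall_of_lt_firstVisit hls.exists_visit (not_le.1 hlt) hin
    have htτ : t ≤ lastVisit R (ω l) ω N := le_lastVisit htN hin
    rcases hsurv l hl with hs | hs
    · exact ⟨0, Nat.zero_le _, by rw [e, h0, le_antisymm hs hσt]⟩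
    · exact ⟨lenAt ρ N ω l, le_rfl, by rw [e, hend, le_antisymm htτ hs]⟩
  · rcases eq_or_ne l' l with rfl | hne
    · exact ⟨u, hu, e⟩
    · obtain ⟨-, -, -, -, hinr⟩ := routeAt_spec ρ (hv.site l' hl')
      rw [e] at hin
      exact absurd hin (not_inBall_of_apart (hv.apart_of_ne hl' hl hne) (hinr u hu))

/-- **The cubes are visited in the order of the sites**: on the final walk, every time whose
value lies in the cube of a listed site `l₂` comes before every time whose value lies in the
cube of a larger listed site `l₁`. [cite: MadrasSlade1993, Lemma 7.2.6 (proof)] -/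
theorem Phi_order : ∀ (js : List ℕ) {N : ℕ} {ω : ℕ → Site (d + 2)}, Valid m R N ω js →
    ∀ l₁ ∈ js, ∀ l₂ ∈ js, l₂ < l₁ → ∀ i₁ i₂, i₁ ≤ (Phi ρ (N, ω) js).1 → i₂ ≤ (Phi ρ (N, ω) js).1 →
      InBall R (ω l₁) ((Phi ρ (N, ω) js).2 i₁) → InBall R (ω l₂) ((Phi ρ (N, ω) js).2 i₂) → i₂ < i₁
  | [], _, _, _, l₁, hl₁, _, _, _, _, _, _, _, _, _ => by simp at hl₁
  | j :: rest, N, ω, hv, l₁, hl₁, l₂, hl₂, hlt, i₁, i₂, hi₁, hi₂, hin₁, hin₂ => by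
    have hj := hv.site j (by simp)
    obtain ⟨h1, h2, h3, h4, h5, h6⟩ := fvis_spec hj
    have hgaps := List.pairwise_cons.1 hv.gaps
    have haps := List.pairwise_cons.1 hv.apart
    have epair : ((op ρ (N, ω) j).1, (op ρ (N, ω) j).2) = op ρ (N, ω) j := Prod.mk.eta
    have hl₁j : l₁ ≤ j := by
      rcases List.mem_cons.1 hl₁ with h | h
      · exact h.le
      · have := hgaps.1 l₁ h; omega
    have hl₂' : l₂ ∈ rest := by
      rcases List.mem_cons.1 hl₂ with h | h
      · omega
      · exact h
    simp only [Phi] at hi₁ hi₂ hin₁ hin₂ ⊢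
    by_cases hhead : l₁ = j
    · -- the head against a later (smaller) site
      rw [hhead] at hin₁
      have hl₂s := hv.site l₂ (by simp [hl₂'])
      have hl₂N := hl₂s.lt_N
      have hgap₂ := hgaps.1 l₂ hl₂'
      have hop1 : (op ρ (N, ω) j).1 = fvis R ω j + lenAt ρ N ω j + (N - lastVisit R (ω j) ω N) := by
        rw [op_eq' hj]
      have hmem := (Phi_spec (ρ := ρ) rest (hv.op_cons (ρ := ρ))).1
      rw [epair] at hmem
      have hinj := (mem_saws.1 hmem).2.2.2
      have hsuf := Phi_suffix_exact (ρ := ρ) rest (hv.op_cons (ρ := ρ)) (j - m)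
        (fun l hl => by have := hgaps.1 l hl; omega)
      rw [epair] at hsuf
      obtain ⟨-, -, -, -, hinr⟩ := routeAt_spec ρ hj
      -- (b) the time `i₁` comes from an op-time `t ≥ σ_j`
      have hb : ∃ t, fvis R ω j ≤ t ∧ t ≤ (op ρ (N, ω) j).1 ∧ i₁ + (op ρ (N, ω) j).1 = t + (Phi ρ (op ρ (N, ω) j) rest).1 := by
        rcases Phi_points (ρ := ρ) rest (hv.op_cons (ρ := ρ)) i₁ with ⟨t, htN, -, e⟩ | ⟨l', hl', u, hu, e⟩
        · rw [epair] at e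
          have hσt : fvis R ω j ≤ t := by
            rcases op_trichotomy ρ hj t with ⟨ht, e'⟩ | ⟨u, -, rfl, -⟩ | ⟨t', -, -, h3', -⟩
            · rw [e, e'] at hin₁
              rw [fvis_eq hj.exists_visit]
              by_contra hlt
              exact not_inBall_of_lt_firstVisit hj.exists_visit (not_le.1 hlt) hin₁
            · omega
            · omega
          obtain ⟨k1, k2, k3⟩ := hsuf t (by omega) htN
          have := hinj hi₁ k2 (by rw [k3, e])
          exact ⟨t, hσt, htN, by omega⟩
        · rw [epair] at e
          obtain ⟨-, -, -, hlen, hroute⟩ := site_data_op' (ρ := ρ) hj (hv.site l' (by simp [hl'])) (hgaps.1 l' hl') (haps.1 l' hl')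
          rw [hlen] at hu; rw [hroute] at e
          obtain ⟨-, -, -, -, hinr'⟩ := routeAt_spec ρ (hv.site l' (by simp [hl']))
          rw [e] at hin₁
          exact absurd (hinr' u hu) (not_inBall_of_apart (haps.1 l' hl') hin₁)
      -- (a) the time `i₂` comes from an op-time `< j - m`
      have ha : i₂ + (op ρ (N, ω) j).1 < j - m + (Phi ρ (op ρ (N, ω) j) rest).1 := by
        by_contra hge
        push Not at hge
        obtain ⟨k1, k2, k3⟩ := hsuf (i₂ + (op ρ (N, ω) j).1 - (Phi ρ (op ρ (N, ω) j) rest).1) (by omega) (by omega)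
        have hk0 := (hsuf (j - m) le_rfl (by omega)).1
        rw [show i₂ + (op ρ (N, ω) j).1 - (Phi ρ (op ρ (N, ω) j) rest).1 + (Phi ρ (op ρ (N, ω) j) rest).1 -
          (op ρ (N, ω) j).1 = i₂ by omega] at k3
        rw [k3] at hin₂
        rcases op_trichotomy ρ hj (i₂ + (op ρ (N, ω) j).1 - (Phi ρ (op ρ (N, ω) j) rest).1) with
          ⟨ht, e'⟩ | ⟨u, hu, -, e'⟩ | ⟨t', h1', h2', -, e'⟩
        · rw [e'] at hin₂
          have := (hl₂s.visits _ (by omega) hin₂).2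
          omega
        · rw [e'] at hin₂
          exact not_inBall_of_apart (haps.1 l₂ hl₂') (hinr u hu) hin₂
        · rw [e'] at hin₂
          have := (hl₂s.visits _ h2' hin₂).2
          omega
      obtain ⟨t, hσt, -, hi⟩ := hb
      omega
    · -- both sites in the rest: induction
      have hl₁' : l₁ ∈ rest := (List.mem_cons.1 hl₁).resolve_left hhead
      have e₁ := (site_data_op' (ρ := ρ) hj (hv.site l₁ (by simp [hl₁'])) (hgaps.1 l₁ hl₁') (haps.1 l₁ hl₁')).1
      have e₂ := (site_data_op' (ρ := ρ) hj (hv.site l₂ (by simp [hl₂'])) (hgaps.1 l₂ hl₂') (haps.1 l₂ hl₂')).1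
      have := Phi_order rest (hv.op_cons (ρ := ρ)) l₁ hl₁' l₂ hl₂' hlt i₁ i₂
      rw [epair, e₁, e₂] at this
      exact this hi₁ hi₂ hin₁ hin₂

end Exact

/-! ### Marked route providers; valid finite sets of sites; marker times on the final walk -/

section Marked

variable {d : ℕ}

/-- A route provider together with a **marker time** on each of its routes (the time of the
point of the route by which the cube will be recognised on the modified walk). [folklore] -/
structure MarkedRouteProvider (d : ℕ) (R : ℤ) (Λ : ℕ) extends RouteProvider d R Λ where
  /-- the marker time on the route from `x` to `y` in the cube centred at `c` -/
  mtime : Site (d + 2) → Site (d + 2) → Site (d + 2) → ℕ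
  /-- it is a time of the route -/
  mtime_le : ∀ c x y, mtime c x y ≤ len c x y

variable {R : ℤ} {Λ m N : ℕ} (ρ : MarkedRouteProvider d R Λ)

/-- The marker time offset at the site `l` of `(N, ω)`. [folklore] -/
def mtAt (N : ℕ) (ω : ℕ → Site (d + 2)) (l : ℕ) : ℕ :=
  ρ.mtime (ω l) (ω (fvis R ω l)) (ω (lastVisit R (ω l) ω N))

/-- The marker point of the site `l` of `(N, ω)`. [folklore] -/
def mptAt (N : ℕ) (ω : ℕ → Site (d + 2)) (l : ℕ) : Site (d + 2) :=
  routeAt ρ.toRouteProvider N ω l (mtAt ρ N ω l)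

/-- The marker time offset is at most the length of the route. [folklore] -/
theorem mtAt_le (ω : ℕ → Site (d + 2)) (l : ℕ) : mtAt ρ N ω l ≤ lenAt ρ.toRouteProvider N ω l :=
  ρ.mtime_le _ _ _

/-- The sites of a finite set, listed in decreasing order. [folklore] -/
def sitesOf (J : Finset ℕ) : List ℕ := J.sort (· ≥ ·)

/-- Membership in the list of sites. [folklore] -/
theorem mem_sitesOf {J : Finset ℕ} {a : ℕ} : a ∈ sitesOf J ↔ a ∈ J := Finset.mem_sort _

/-- The list of sites has the cardinality of the set as length. [folklore] -/
theorem length_sitesOf (J : Finset ℕ) : (sitesOf J).length = J.card := Finset.length_sort _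

/-- The list of sites is strictly decreasing. [folklore] -/
theorem sitesOf_pairwise (J : Finset ℕ) : (sitesOf J).Pairwise (· > ·) := (Finset.sortedGT_sort J).pairwise

/-- A **valid finite set of sites** for `(N, ω)`: surgery sites with windows `[j-m, j+m]`,
pairwise separated by more than `2m` in time and by more than `2R` in space.
[cite: MadrasSlade1993, Lemma 7.2.6 (proof), (7.2.17)–(7.2.18)] -/
structure ValidSet (m : ℕ) (R : ℤ) (N : ℕ) (ω : ℕ → Site (d + 2)) (M : Finset ℕ) : Prop where
  mem : ω ∈ saws (d + 2) N
  site : ∀ j ∈ M, SurgerySite ω N R j (j - m) (j + m)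
  gaps : ∀ a ∈ M, ∀ b ∈ M, a < b → a + 2 * m + 1 ≤ b
  apart : ∀ a ∈ M, ∀ b ∈ M, a ≠ b → ∃ k, 2 * R < |ω a k - ω b k|

variable {ρ} {ω : ℕ → Site (d + 2)} {M J : Finset ℕ}

/-- Validity passes to subsets. [folklore] -/
theorem ValidSet.subset (h : ValidSet m R N ω M) (hJ : J ⊆ M) : ValidSet m R N ω J :=
  ⟨h.mem, fun j hj => h.site j (hJ hj), fun a ha b hb => h.gaps a (hJ ha) b (hJ hb),
    fun a ha b hb => h.apart a (hJ ha) b (hJ hb)⟩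

/-- The decreasing list of a valid finite set is a valid list. [folklore] -/
theorem ValidSet.valid (h : ValidSet m R N ω J) : Valid m R N ω (sitesOf J) := by
  have hp := sitesOf_pairwise J
  refine ⟨h.mem, fun j hj => h.site j (mem_sitesOf.1 hj), ?_, ?_⟩
  · exact hp.imp_of_mem fun {a b} ha hb hab => h.gaps b (mem_sitesOf.1 hb) a (mem_sitesOf.1 ha) hab
  · exact hp.imp_of_mem fun {a b} ha hb hab => h.apart a (mem_sitesOf.1 ha) b (mem_sitesOf.1 hb) (ne_of_gt hab)

variable (ρ)

/-- The final walk of the multi-site operation along the finite set `J`. [folklore] -/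
def PhiJ (N : ℕ) (ω : ℕ → Site (d + 2)) (J : Finset ℕ) : ℕ × (ℕ → Site (d + 2)) :=
  Phi ρ.toRouteProvider (N, ω) (sitesOf J)

open Classical in
/-- The **marker time** of the site `l` on the final walk: the (unique) time at which the final
walk is at the marker point of `l`. [folklore] -/
def mtimeOf (N : ℕ) (ω : ℕ → Site (d + 2)) (J : Finset ℕ) (l : ℕ) : ℕ :=
  Nat.findGreatest (fun t => (PhiJ ρ N ω J).2 t = mptAt ρ N ω l) (PhiJ ρ N ω J).1

variable {ρ}

/-- The marker point lies in the cube. [folklore] -/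
theorem mptAt_inBall (ρ : MarkedRouteProvider d R Λ) {l : ℕ} (hl : SurgerySite ω N R l (l - m) (l + m)) :
    InBall R (ω l) (mptAt ρ N ω l) :=
  (routeAt_spec ρ.toRouteProvider hl).2.2.2.2 _ (mtAt_le ρ ω l)

/-- The final walk is self-avoiding, of length `≤ N + Λ |J|`. [folklore] -/
theorem PhiJ_mem (ρ : MarkedRouteProvider d R Λ) (h : ValidSet m R N ω J) :
    (PhiJ ρ N ω J).2 ∈ saws (d + 2) (PhiJ ρ N ω J).1 ∧ (PhiJ ρ N ω J).1 ≤ N + Λ * J.card ∧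
      N ≤ (PhiJ ρ N ω J).1 + 2 * m * J.card := by
  obtain ⟨h1, h2, h3, -⟩ := Phi_spec (ρ := ρ.toRouteProvider) (sitesOf J) h.valid
  rw [length_sitesOf] at h2 h3
  exact ⟨h1, h2, h3⟩

/-- **The marker time is on the route block of its site**, at offset `mtAt`. [folklore] -/
theorem mtimeOf_block (ρ : MarkedRouteProvider d R Λ) (h : ValidSet m R N ω J) {l : ℕ} (hl : l ∈ J) :
    ∃ t₀, t₀ + lenAt ρ.toRouteProvider N ω l ≤ (PhiJ ρ N ω J).1 ∧
      (∀ s ≤ lenAt ρ.toRouteProvider N ω l, (PhiJ ρ N ω J).2 (t₀ + s) = routeAt ρ.toRouteProvider N ω l s) ∧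
      mtimeOf ρ N ω J l = t₀ + mtAt ρ N ω l := by
  classical
  obtain ⟨t₀, ht₀, hblk⟩ := Phi_blocks' (ρ := ρ.toRouteProvider) h.valid (mem_sitesOf.2 hl)
  change t₀ + _ ≤ (PhiJ ρ N ω J).1 at ht₀
  change ∀ s ≤ _, (PhiJ ρ N ω J).2 (t₀ + s) = _ at hblk
  have hmt := mtAt_le ρ ω l (N := N)
  refine ⟨t₀, ht₀, hblk, ?_⟩
  have hP : (PhiJ ρ N ω J).2 (t₀ + mtAt ρ N ω l) = mptAt ρ N ω l := hblk _ hmt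
  have hspec : (PhiJ ρ N ω J).2 (mtimeOf ρ N ω J l) = mptAt ρ N ω l :=
    Nat.findGreatest_spec (P := fun t => (PhiJ ρ N ω J).2 t = mptAt ρ N ω l) (by
      show t₀ + mtAt ρ N ω l ≤ (PhiJ ρ N ω J).1; omega) hP
  have hle : mtimeOf ρ N ω J l ≤ (PhiJ ρ N ω J).1 :=
    Nat.findGreatest_le (P := fun t => (PhiJ ρ N ω J).2 t = mptAt ρ N ω l) _
  exact (mem_saws.1 (PhiJ_mem ρ h).1).2.2.2 hle (show t₀ + mtAt ρ N ω l ≤ (PhiJ ρ N ω J).1 by omega)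
    (hspec.trans hP.symm)

/-- The marker time is a time of the final walk, at which the walk is at the marker point. [folklore] -/
theorem mtimeOf_spec (ρ : MarkedRouteProvider d R Λ) (h : ValidSet m R N ω J) {l : ℕ} (hl : l ∈ J) :
    mtimeOf ρ N ω J l ≤ (PhiJ ρ N ω J).1 ∧ (PhiJ ρ N ω J).2 (mtimeOf ρ N ω J l) = mptAt ρ N ω l := by
  obtain ⟨t₀, ht₀, hblk, he⟩ := mtimeOf_block ρ h hl
  have hmt := mtAt_le ρ ω l (N := N)
  rw [he]
  exact ⟨by omega, hblk _ hmt⟩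

/-- **Marker times increase with the site.** [folklore] -/
theorem mtimeOf_lt (ρ : MarkedRouteProvider d R Λ) (h : ValidSet m R N ω J) {l₁ l₂ : ℕ} (hl₁ : l₁ ∈ J)
    (hl₂ : l₂ ∈ J) (hlt : l₂ < l₁) : mtimeOf ρ N ω J l₂ < mtimeOf ρ N ω J l₁ := by
  obtain ⟨h1, e1⟩ := mtimeOf_spec ρ h hl₁
  obtain ⟨h2, e2⟩ := mtimeOf_spec ρ h hl₂
  refine Phi_order (ρ := ρ.toRouteProvider) (sitesOf J) h.valid l₁ (mem_sitesOf.2 hl₁) l₂ (mem_sitesOf.2 hl₂) hlt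
    _ _ h1 h2 ?_ ?_
  · rw [show (Phi ρ.toRouteProvider (N, ω) (sitesOf J)).2 (mtimeOf ρ N ω J l₁) = mptAt ρ N ω l₁ from e1]
    exact mptAt_inBall ρ (h.site l₁ hl₁)
  · rw [show (Phi ρ.toRouteProvider (N, ω) (sitesOf J)).2 (mtimeOf ρ N ω J l₂) = mptAt ρ N ω l₂ from e2]
    exact mptAt_inBall ρ (h.site l₂ hl₂)

/-- Marker times are injective on the sites. [folklore] -/
theorem mtimeOf_injOn (ρ : MarkedRouteProvider d R Λ) (h : ValidSet m R N ω J) :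
    Set.InjOn (mtimeOf ρ N ω J) J := by
  intro a ha b hb hab
  by_contra hne
  rcases lt_or_gt_of_ne hne with hlt | hlt
  · exact absurd hab (mtimeOf_lt ρ h hb ha hlt).ne
  · exact absurd hab (mtimeOf_lt ρ h ha hb hlt).ne'

/-- The set of marker times. [folklore] -/
def mtimes (ρ : MarkedRouteProvider d R Λ) (N : ℕ) (ω : ℕ → Site (d + 2)) (J : Finset ℕ) : Finset ℕ :=
  J.image (mtimeOf ρ N ω J)

/-- There are as many marker times as sites. [folklore] -/
theorem card_mtimes (ρ : MarkedRouteProvider d R Λ) (h : ValidSet m R N ω J) : (mtimes ρ N ω J).card = J.card :=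
  Finset.card_image_of_injOn (mtimeOf_injOn ρ h)

/-- **The decreasing list of marker times is the list of marker times of the decreasing sites.**
[folklore] -/
theorem sort_mtimes (ρ : MarkedRouteProvider d R Λ) (h : ValidSet m R N ω J) :
    (mtimes ρ N ω J).sort (· ≥ ·) = (sitesOf J).map (mtimeOf ρ N ω J) := by
  apply (Finset.sortedGT_sort _).eq_of_mem_iff
  · rw [List.sortedGT_iff_pairwise, List.pairwise_map]
    exact (sitesOf_pairwise J).imp_of_mem fun {a b} ha hb hab =>
      mtimeOf_lt ρ h (mem_sitesOf.1 ha) (mem_sitesOf.1 hb) hab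
  · intro a
    rw [Finset.mem_sort, mtimes, Finset.mem_image, List.mem_map]
    simp only [mem_sitesOf]

/-- The `i`-th largest marker time is the marker time of the `i`-th largest site. [folklore] -/
theorem sort_mtimes_getD (ρ : MarkedRouteProvider d R Λ) (h : ValidSet m R N ω J) (i : ℕ) (hi : i < J.card) :
    ((mtimes ρ N ω J).sort (· ≥ ·)).getD i 0 = mtimeOf ρ N ω J ((sitesOf J).getD i 0) := by
  rw [sort_mtimes ρ h, List.getD_eq_getElem _ _ (by rw [List.length_map, length_sitesOf]; exact hi),
    List.getElem_map, List.getD_eq_getElem _ _ (by rw [length_sitesOf]; exact hi)]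

end Marked

/-! ### Equivalent undo data; the removed pieces; the encoding and its left inverse -/

section Encoding

variable {d : ℕ} {R : ℤ} {Λ m N : ℕ}

/-- Two undo data are **equivalent** if they have the same centre and length and their pieces
agree up to the length (only these values are used by `undo`). [folklore] -/
def UndoData.Approx (D D' : UndoData d) : Prop :=
  D.c = D'.c ∧ D.len = D'.len ∧ ∀ s ≤ D.len, D.piece s = D'.piece s

/-- Equivalence of undo data is transitive. [folklore] -/
theorem UndoData.Approx.trans {D D' D'' : UndoData d} (h : D.Approx D') (h' : D'.Approx D'') : D.Approx D'' :=
  ⟨h.1.trans h'.1, h.2.1.trans h'.2.1, fun s hs => (h.2.2 s hs).trans (h'.2.2 s (h.2.1 ▸ hs))⟩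

/-- Equivalence of undo data is symmetric. [folklore] -/
theorem UndoData.Approx.symm {D D' : UndoData d} (h : D.Approx D') : D'.Approx D :=
  ⟨h.1.symm, h.2.1.symm, fun s hs => (h.2.2 s (h.2.1.symm ▸ hs)).symm⟩

/-- Splicing depends only on the values of the piece up to its length. [folklore] -/
theorem splice_congr {ω π π' : ℕ → Site (d + 2)} {σ τ L : ℕ} (h : ∀ s ≤ L, π s = π' s) :
    splice ω σ τ L π = splice ω σ τ L π' := by
  funext t
  simp only [splice]
  split_ifs with h1 h2
  · rfl
  · exact h _ (by omega)
  · rfl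

/-- `undo` respects equivalence of undo data. [folklore] -/
theorem undo_congr {Nψ : ℕ × (ℕ → Site (d + 2))} {D D' : UndoData d} (h : D.Approx D') :
    undo (R := R) Nψ D = undo (R := R) Nψ D' := by
  obtain ⟨c, len, piece⟩ := D
  obtain ⟨c', len', piece'⟩ := D'
  obtain ⟨hc, hl, hp⟩ := h
  simp only at hc hl hp
  subst hc
  subst hl
  unfold undo
  simp only
  split_ifs with hvis
  · simp only [Prod.mk.injEq, true_and]
    exact splice_congr fun s hs => by rw [hp s hs]
  · rfl

/-- `Decode` respects equivalence of the lists of undo data. [folklore] -/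
theorem Decode_congr {Nψ : ℕ × (ℕ → Site (d + 2))} :
    ∀ {Ds Ds' : List (UndoData d)}, List.Forall₂ UndoData.Approx Ds Ds' →
      Decode (R := R) Nψ Ds = Decode (R := R) Nψ Ds'
  | [], [], _ => rfl
  | D :: Ds, D' :: Ds', h => by
    obtain ⟨h1, h2⟩ := List.forall₂_cons.1 h
    simp only [Decode]
    rw [Decode_congr h2, undo_congr h1]

variable {ω : ℕ → Site (d + 2)} {j : ℕ}

/-- The undo data at a surgery site. [folklore] -/
theorem undoDataOf_eq (h : SurgerySite ω N R j (j - m) (j + m)) :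
    undoDataOf R (N, ω) j = ⟨ω j, lastVisit R (ω j) ω N - fvis R ω j,
      fun s => ω (fvis R ω j + s) - ω (fvis R ω j)⟩ := by
  unfold undoDataOf
  simp only [dif_pos h.exists_visit]
  rw [fvis_eq h.exists_visit]

/-- The undo data of an earlier, far-away site are equivalent before and after an operation.
[folklore] -/
theorem undoDataOf_op_approx (ρ : RouteProvider d R Λ) (hj : SurgerySite ω N R j (j - m) (j + m)) {l : ℕ}
    (hl : SurgerySite ω N R l (l - m) (l + m)) (hlj : l + 2 * m + 1 ≤ j) (hap : ∃ k, 2 * R < |ω j k - ω l k|) :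
    (undoDataOf R (op ρ (N, ω) j) l).Approx (undoDataOf R (N, ω) l) := by
  have hl' := op_preserves ρ hj hl hlj hap
  obtain ⟨hll, hf, hlast, hσe, -⟩ := site_data_op' (ρ := ρ) hj hl hlj hap
  have epair : ((op ρ (N, ω) j).1, (op ρ (N, ω) j).2) = op ρ (N, ω) j := Prod.mk.eta
  rw [← epair, undoDataOf_eq hl', undoDataOf_eq hl]
  have h1 := (fvis_spec hj).1
  obtain ⟨-, hl2, -, hl4, hl5, -⟩ := fvis_spec hl
  refine ⟨hll, by simp only; rw [hf, hlast], fun s hs => ?_⟩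
  simp only at hs ⊢
  rw [hf, hlast] at hs
  rw [hf]
  have e1 : (op ρ (N, ω) j).2 (fvis R ω l + s) = ω (fvis R ω l + s) :=
    op_apply_of_le ρ hj (by rw [← fvis_eq hj.exists_visit]; omega)
  have e2 : (op ρ (N, ω) j).2 (fvis R ω l) = ω (fvis R ω l) :=
    op_apply_of_le ρ hj (by rw [← fvis_eq hj.exists_visit]; omega)
  rw [e1, e2]

/-- **The list of undo data is, up to equivalence, the list of the undo data of the sites on
the original walk** (and hence any pointwise-equivalent list). [folklore] -/
theorem dataList_approx (ρ : RouteProvider d R Λ) (g : ℕ → UndoData d) :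
    ∀ (js : List ℕ) {N : ℕ} {ω : ℕ → Site (d + 2)}, Valid m R N ω js →
      (∀ l ∈ js, (undoDataOf R (N, ω) l).Approx (g l)) →
      List.Forall₂ UndoData.Approx (dataList ρ (N, ω) js) (js.map g)
  | [], _, _, _, _ => by simp [dataList]
  | j :: rest, N, ω, hv, hg => by
    have hj := hv.site j (by simp)
    have hgaps := List.pairwise_cons.1 hv.gaps
    have haps := List.pairwise_cons.1 hv.apart
    simp only [dataList, List.map_cons]
    refine List.Forall₂.cons (hg j (by simp)) ?_
    have ih := dataList_approx ρ g rest (hv.op_cons (ρ := ρ)) fun l hl =>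
      (undoDataOf_op_approx ρ hj (hv.site l (by simp [hl])) (hgaps.1 l hl) (haps.1 l hl)).trans (hg l (by simp [hl]))
    have epair : ((op ρ (N, ω) j).1, (op ρ (N, ω) j).2) = op ρ (N, ω) j := Prod.mk.eta
    rwa [epair] at ih

/-- Freezing a self-avoiding path after its length keeps a self-avoiding path. [folklore] -/
theorem PathOn.freeze {D n : ℕ} {π : ℕ → Site D} (h : PathOn n π) : PathOn n fun u => π (min u n) := by
  refine ⟨fun t ht => ?_, fun s hs t ht hst => ?_⟩
  · simp only [show min t n = t by omega, show min (t + 1) n = t + 1 by omega]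
    exact h.1 t ht
  · simp only [Set.mem_setOf_eq] at hs ht hst
    rw [show min s n = s by omega, show min t n = t by omega] at hst
    exact h.2 hs ht hst

/-- **The removed piece** at the site `l`, translated to start at `0` and frozen after its
length `τ_l - σ_l`. [folklore] -/
def pieceAt (R : ℤ) (N : ℕ) (ω : ℕ → Site (d + 2)) (l : ℕ) : ℕ → Site (d + 2) := fun u =>
  -ω (fvis R ω l) + ω (fvis R ω l + min u (lastVisit R (ω l) ω N - fvis R ω l))

/-- The removed piece is a self-avoiding walk of length `τ - σ ≤ 2m`. [folklore] -/
theorem pieceAt_mem (h : SurgerySite ω N R j (j - m) (j + m)) :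
    pieceAt R N ω j ∈ saws (d + 2) (lastVisit R (ω j) ω N - fvis R ω j) ∧
      lastVisit R (ω j) ω N - fvis R ω j ≤ 2 * m := by
  obtain ⟨h1, h2, h3, h4, h5, h6⟩ := fvis_spec h
  refine ⟨mem_saws_of_pathOn ?_ (by simp [pieceAt]) fun t ht => ?_, by omega⟩
  · have hp : PathOn (lastVisit R (ω j) ω N - fvis R ω j) fun t => ω (fvis R ω j + t) :=
      ((pathOn_of_mem_saws h.mem).shift (k := fvis R ω j) (by omega)).mono (by omega)
    exact (hp.freeze.add_const (-ω (fvis R ω j)))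
  · simp only [pieceAt, min_eq_right ht, min_self]

/-- Values of the removed piece up to its length. [folklore] -/
theorem pieceAt_apply {l u : ℕ} (hu : u ≤ lastVisit R (ω l) ω N - fvis R ω l) :
    pieceAt R N ω l u = ω (fvis R ω l + u) - ω (fvis R ω l) := by
  simp only [pieceAt, min_eq_left hu]; abel

variable (ρ : MarkedRouteProvider d R Λ) (N s : ℕ)

/-- The `i`-th largest site of `J` (junk `0` beyond the cardinality). [folklore] -/
def siteAt (J : Finset ℕ) (i : ℕ) : ℕ := (sitesOf J).getD i 0

/-- **The code of a pair (walk, set of `s` sites)**: the final walk with its length, the set of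
marker times, and, for each rank `i < s` (sites in decreasing order), the offset of the marker
point from the centre, the length of the removed piece and the removed piece.
[cite: MadrasSlade1993, Lemma 7.2.6 (proof)] -/
def cubeCode (ω : ℕ → Site (d + 2)) (J : Finset ℕ) :
    ((ℕ × (ℕ → Site (d + 2))) × Finset ℕ) × (Fin s → Site (d + 2)) × (Fin s → ℕ) × (Fin s → ℕ → Site (d + 2)) :=
  ((PhiJ ρ N ω J, mtimes ρ N ω J), fun i => mptAt ρ N ω (siteAt J i) - ω (siteAt J i),
    fun i => lastVisit R (ω (siteAt J i)) ω N - fvis R ω (siteAt J i), fun i => pieceAt R N ω (siteAt J i))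

/-- The undo data read off a code: the `i`-th largest marker time locates the `i`-th cube.
[folklore] -/
def reconData (w : ℕ × (ℕ → Site (d + 2))) (S : Finset ℕ) (offs : Fin s → Site (d + 2)) (lens : Fin s → ℕ)
    (pieces : Fin s → ℕ → Site (d + 2)) : List (UndoData d) :=
  List.ofFn fun i : Fin s => (⟨w.2 ((S.sort (· ≥ ·)).getD i 0) - offs i, lens i, pieces i⟩ : UndoData d)

/-- **Reconstruction** of the original walk from a code. [folklore] -/
def recon (cd : ((ℕ × (ℕ → Site (d + 2))) × Finset ℕ) × (Fin s → Site (d + 2)) × (Fin s → ℕ) ×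
    (Fin s → ℕ → Site (d + 2))) : ℕ × (ℕ → Site (d + 2)) :=
  Decode (R := R) cd.1.1 (reconData s cd.1.1 cd.1.2 cd.2.1 cd.2.2.1 cd.2.2.2)

variable {ρ N s} {J : Finset ℕ}

/-- `siteAt` is the list entry. [folklore] -/
theorem siteAt_eq {i : ℕ} (hi : i < J.card) : siteAt J i = (sitesOf J)[i]'(by rw [length_sitesOf]; exact hi) :=
  List.getD_eq_getElem _ _ _

/-- `siteAt J i ∈ J` for `i < |J|`. [folklore] -/
theorem siteAt_mem {i : ℕ} (hi : i < J.card) : siteAt J i ∈ J := by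
  rw [siteAt_eq hi, ← mem_sitesOf]; exact List.getElem_mem _

/-- The `i`-th largest marker time is the marker time of `siteAt J i`. [folklore] -/
theorem sort_mtimes_siteAt (h : ValidSet m R N ω J) {i : ℕ} (hi : i < J.card) :
    ((mtimes ρ N ω J).sort (· ≥ ·)).getD i 0 = mtimeOf ρ N ω J (siteAt J i) :=
  sort_mtimes_getD ρ h i hi

/-- **The reconstruction is a left inverse of the code** on valid pairs.
[cite: MadrasSlade1993, Lemma 7.2.6 (proof)] -/
theorem recon_cubeCode (h : ValidSet m R N ω J) (hs : J.card = s) : recon s (R := R) (cubeCode ρ N s ω J) = (N, ω) := by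
  -- the undo data as a function of the site
  set g : ℕ → UndoData d := fun l => ⟨(PhiJ ρ N ω J).2 (mtimeOf ρ N ω J l) - (mptAt ρ N ω l - ω l),
    lastVisit R (ω l) ω N - fvis R ω l, pieceAt R N ω l⟩ with hg
  have happrox : ∀ l ∈ sitesOf J, (undoDataOf R (N, ω) l).Approx (g l) := by
    intro l hl
    rw [mem_sitesOf] at hl
    rw [undoDataOf_eq (h.site l hl)]
    refine ⟨?_, rfl, fun u hu => ?_⟩
    · simp only [hg, (mtimeOf_spec ρ h hl).2, sub_sub_cancel]
    · simp only [hg] at hu ⊢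
      rw [pieceAt_apply hu]
  have hlist : reconData s (PhiJ ρ N ω J) (mtimes ρ N ω J) (fun i => mptAt ρ N ω (siteAt J i) - ω (siteAt J i))
      (fun i => lastVisit R (ω (siteAt J i)) ω N - fvis R ω (siteAt J i)) (fun i => pieceAt R N ω (siteAt J i)) =
      (sitesOf J).map g := by
    apply List.ext_getElem (by simp [reconData, length_sitesOf, hs])
    intro i h₁ h₂
    have hi : i < J.card := by rw [List.length_map, length_sitesOf] at h₂; exact h₂
    simp only [reconData, List.getElem_ofFn, List.getElem_map, hg]
    rw [sort_mtimes_getD ρ h i hi, ← siteAt_eq hi]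
    simp only [siteAt]
  unfold recon cubeCode
  simp only
  rw [hlist, ← Decode_congr (dataList_approx ρ.toRouteProvider g (sitesOf J) h.valid happrox)]
  exact Decode_Phi (sitesOf J) h.valid

/-- Sites of a valid set are times `≤ N`. [folklore] -/
theorem ValidSet.le_N (h : ValidSet m R N ω J) {l : ℕ} (hl : l ∈ J) : l ≤ N := by
  have := (h.site l hl).j_le; have := (h.site l hl).lt_N; omega

/-- **Injectivity of the code** on valid pairs with `s` sites. [cite: MadrasSlade1993, Lemma 7.2.6 (proof)] -/
theorem cubeCode_inj {ω ω' : ℕ → Site (d + 2)} {J J' : Finset ℕ} (h : ValidSet m R N ω J) (h' : ValidSet m R N ω' J')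
    (hs : J.card = s) (hs' : J'.card = s) (he : cubeCode ρ N s ω J = cubeCode ρ N s ω' J') : ω = ω' ∧ J = J' := by
  have hω : ω = ω' := by
    have e1 := recon_cubeCode (ρ := ρ) h hs
    rw [he, recon_cubeCode (ρ := ρ) h' hs'] at e1
    exact (Prod.mk.inj e1).2.symm
  subst hω
  refine ⟨rfl, ?_⟩
  simp only [cubeCode, Prod.mk.injEq] at he
  obtain ⟨⟨hΨ, hS⟩, hoffs, -, -⟩ := he
  -- the `i`-th sites agree, since their images under `ω` agree
  have key : ∀ i, i < s → siteAt J i = siteAt J' i := by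
    intro i hi
    have hl := siteAt_mem (J := J) (by omega : i < J.card)
    have hl' := siteAt_mem (J := J') (by omega : i < J'.card)
    have c1 := (mtimeOf_spec ρ h hl).2
    have c2 := (mtimeOf_spec ρ h' hl').2
    rw [← sort_mtimes_siteAt (ρ := ρ) h (by omega)] at c1
    rw [← sort_mtimes_siteAt (ρ := ρ) h' (by omega)] at c2
    have hoff := congrFun hoffs ⟨i, hi⟩
    simp only at hoff
    have hpt : ω (siteAt J i) = ω (siteAt J' i) := by
      have e : mptAt ρ N ω (siteAt J i) = mptAt ρ N ω (siteAt J' i) := by rw [← c1, ← c2, hΨ, hS]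
      rw [e, sub_right_inj] at hoff
      exact hoff
    exact (mem_saws.1 h.mem).2.2.2 (h.le_N hl) (h'.le_N hl') hpt
  have hlist : sitesOf J = sitesOf J' := by
    apply List.ext_getElem (by rw [length_sitesOf, length_sitesOf, hs, hs'])
    intro i h₁ h₂
    have hi : i < s := by rw [length_sitesOf, hs] at h₁; exact h₁
    have := key i hi
    rwa [siteAt_eq (by omega), siteAt_eq (by omega)] at this
  ext a
  rw [← mem_sitesOf, ← mem_sitesOf, hlist]

end Encoding


/-! ### The counting inequality -/

section Counting

variable {d : ℕ} {R : ℤ} {Λ m : ℕ}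

open Classical in
/-- All self-avoiding walks of length `≤ K`, paired with their lengths. [folklore] -/
def walksUpTo (d K : ℕ) : Finset (ℕ × (ℕ → Site (d + 2))) :=
  (Finset.range (K + 1)).biUnion fun n => (saws (d + 2) n).image fun ψ => (n, ψ)

/-- `#walksUpTo ≤ Σ_{n ≤ K} c_n`. [folklore] -/
theorem card_walksUpTo (d K : ℕ) : (walksUpTo d K).card ≤ ∑ n ∈ Finset.range (K + 1), count (d + 2) n := by
  classical
  refine Finset.card_biUnion_le.trans (Finset.sum_le_sum fun n _ => ?_)
  rw [Finset.card_image_of_injective _ fun ψ ψ' h => (Prod.mk.inj h).2, card_saws]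

/-- Membership in `walksUpTo`. [folklore] -/
theorem mem_walksUpTo {K n : ℕ} {ψ : ℕ → Site (d + 2)} : (n, ψ) ∈ walksUpTo d K ↔ n ≤ K ∧ ψ ∈ saws (d + 2) n := by
  classical
  simp only [walksUpTo, Finset.mem_biUnion, Finset.mem_range, Finset.mem_image, Prod.mk.injEq]
  constructor
  · rintro ⟨n', hn', ψ', hψ', rfl, rfl⟩
    exact ⟨by omega, hψ'⟩
  · rintro ⟨hn, hψ⟩
    exact ⟨n, by omega, ψ, hψ, rfl, rfl⟩

variable (mkT : ℕ × (ℕ → Site (d + 2)) → Finset ℕ)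

open Classical in
/-- Walks of length `≤ K` with at most `B₀` marker times, paired with an `s`-subset of their
marker times. [folklore] -/
def markedWalks (K B₀ s : ℕ) : Finset ((ℕ × (ℕ → Site (d + 2))) × Finset ℕ) :=
  ((walksUpTo d K).filter fun w => (mkT w).card ≤ B₀).biUnion fun w =>
    ((mkT w).powersetCard s).image fun S => (w, S)

/-- `#markedWalks ≤ (Σ_{n ≤ K} c_n) · C(B₀, s)`. [folklore] -/
theorem card_markedWalks (K B₀ s : ℕ) :
    (markedWalks mkT K B₀ s).card ≤ (∑ n ∈ Finset.range (K + 1), count (d + 2) n) * B₀.choose s := by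
  classical
  unfold markedWalks
  refine Finset.card_biUnion_le.trans ?_
  calc ∑ w ∈ (walksUpTo d K).filter (fun w => (mkT w).card ≤ B₀), (((mkT w).powersetCard s).image fun S => (w, S)).card
      ≤ ∑ w ∈ (walksUpTo d K).filter (fun w => (mkT w).card ≤ B₀), B₀.choose s := by
        refine Finset.sum_le_sum fun w hw => ?_
        rw [Finset.mem_filter] at hw
        exact Finset.card_image_le.trans (by rw [Finset.card_powersetCard]; exact Nat.choose_le_choose s hw.2)
    _ = ((walksUpTo d K).filter fun w => (mkT w).card ≤ B₀).card * B₀.choose s := by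
        rw [Finset.sum_const, smul_eq_mul]
    _ ≤ (walksUpTo d K).card * B₀.choose s := Nat.mul_le_mul_right _ (Finset.card_filter_le _ _)
    _ ≤ _ := Nat.mul_le_mul_right _ (card_walksUpTo d K)

/-- Membership in `markedWalks`. [folklore] -/
theorem mem_markedWalks {K B₀ s : ℕ} {w : ℕ × (ℕ → Site (d + 2))} {S : Finset ℕ} :
    (w, S) ∈ markedWalks mkT K B₀ s ↔ w ∈ walksUpTo d K ∧ (mkT w).card ≤ B₀ ∧ S ⊆ mkT w ∧ S.card = s := by
  classical
  simp only [markedWalks, Finset.mem_biUnion, Finset.mem_filter, Finset.mem_image, Finset.mem_powersetCard,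
    Prod.mk.injEq]
  constructor
  · rintro ⟨w', ⟨hw', hB⟩, S', ⟨hS', hc⟩, rfl, rfl⟩
    exact ⟨hw', hB, hS', hc⟩
  · rintro ⟨hw, hB, hS, hc⟩
    exact ⟨w, ⟨hw, hB⟩, S, ⟨hS, hc⟩, rfl, rfl⟩

open Classical in
/-- Self-avoiding walks of length `≤ 2m` (the possible removed pieces). [folklore] -/
def removedPieces (d m : ℕ) : Finset (ℕ → Site (d + 2)) :=
  (Finset.range (2 * m + 1)).biUnion fun n => saws (d + 2) n

/-- `#removedPieces ≤ Σ_{n ≤ 2m} c_n`. [folklore] -/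
theorem card_removedPieces (d m : ℕ) : (removedPieces d m).card ≤ ∑ n ∈ Finset.range (2 * m + 1), count (d + 2) n := by
  classical
  exact Finset.card_biUnion_le.trans (by simp [card_saws])

open Classical in
/-- The target set of the code. [folklore] -/
def codeTarget (K B₀ s m Rn : ℕ) : Finset (((ℕ × (ℕ → Site (d + 2))) × Finset ℕ) × (Fin s → Site (d + 2)) ×
    (Fin s → ℕ) × (Fin s → ℕ → Site (d + 2))) :=
  markedWalks mkT K B₀ s ×ˢ (Fintype.piFinset fun _ : Fin s => box (d + 2) Rn) ×ˢ
    (Fintype.piFinset fun _ : Fin s => Finset.range (2 * m + 1)) ×ˢ (Fintype.piFinset fun _ : Fin s => removedPieces d m)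

/-- Cardinality of the target set. [folklore] -/
theorem card_codeTarget (K B₀ s m Rn : ℕ) :
    (codeTarget mkT K B₀ s m Rn).card ≤ (∑ n ∈ Finset.range (K + 1), count (d + 2) n) * B₀.choose s *
      ((2 * Rn + 1) ^ (d + 2)) ^ s * (2 * m + 1) ^ s * (∑ n ∈ Finset.range (2 * m + 1), count (d + 2) n) ^ s := by
  classical
  unfold codeTarget
  rw [Finset.card_product, Finset.card_product, Finset.card_product, Fintype.card_piFinset, Fintype.card_piFinset,
    Fintype.card_piFinset]
  simp only [Finset.prod_const, Finset.card_univ, Fintype.card_fin, card_box, Finset.card_range]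
  have h1 := card_markedWalks mkT K B₀ s
  have h2 := card_removedPieces d m
  calc (markedWalks mkT K B₀ s).card * (((2 * Rn + 1) ^ (d + 2)) ^ s * ((2 * m + 1) ^ s * (removedPieces d m).card ^ s))
      ≤ (∑ n ∈ Finset.range (K + 1), count (d + 2) n) * B₀.choose s *
          (((2 * Rn + 1) ^ (d + 2)) ^ s * ((2 * m + 1) ^ s * (∑ n ∈ Finset.range (2 * m + 1), count (d + 2) n) ^ s)) :=
        Nat.mul_le_mul h1 (Nat.mul_le_mul_left _ (Nat.mul_le_mul_left _ (Nat.pow_le_pow_left h2 s)))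
    _ = _ := by ring

variable (ρ : MarkedRouteProvider d R Λ) (N s B₀ : ℕ)

/-- **The code of a valid pair lies in the target set.** [cite: MadrasSlade1993, Lemma 7.2.6 (proof)] -/
theorem cubeCode_mem_codeTarget {ω : ℕ → Site (d + 2)} {J : Finset ℕ} (h : ValidSet m R N ω J) (hs : J.card = s)
    (h1 : ∀ l ∈ J, mtimeOf ρ N ω J l ∈ mkT (PhiJ ρ N ω J)) (h2 : (mkT (PhiJ ρ N ω J)).card ≤ B₀) (hR : 0 ≤ R) :
    cubeCode ρ N s ω J ∈ codeTarget mkT (N + Λ * s) B₀ s m R.toNat := by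
  classical
  unfold cubeCode codeTarget
  simp only [Finset.mem_product, Fintype.mem_piFinset, Finset.mem_range]
  refine ⟨?_, fun i => ?_, fun i => ?_, fun i => ?_⟩
  · rw [mem_markedWalks]
    obtain ⟨hmem, hlen, -⟩ := PhiJ_mem ρ h
    refine ⟨?_, h2, fun t ht => ?_, by rw [card_mtimes ρ h, hs]⟩
    · show ((PhiJ ρ N ω J).1, (PhiJ ρ N ω J).2) ∈ walksUpTo d (N + Λ * s)
      exact mem_walksUpTo.2 ⟨by rw [← hs]; exact hlen, hmem⟩
    · obtain ⟨l, hl, rfl⟩ := Finset.mem_image.1 ht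
      exact h1 l hl
  · have hl := siteAt_mem (J := J) (i := i) (by omega)
    have hin := mptAt_inBall ρ (h.site _ hl) (N := N)
    rw [mem_box]
    intro k
    have := hin k
    rw [Int.toNat_of_nonneg hR, Pi.sub_apply]
    exact abs_le.1 this
  · have := (pieceAt_mem (h.site _ (siteAt_mem (J := J) (i := i) (by omega)))).2
    omega
  · obtain ⟨hmem, hle⟩ := pieceAt_mem (h.site _ (siteAt_mem (J := J) (i := i) (by omega)))
    unfold removedPieces
    rw [Finset.mem_biUnion]
    exact ⟨_, Finset.mem_range.2 (by omega), hmem⟩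

/-- **The counting inequality of the cube surgery**: if every walk of `T` carries a valid set
`M ω` of surgery sites, every marker time of the modified walks is one of at most `B₀`
recognisable times, then `Σ_{ω ∈ T} C(|M ω|, s)` (the number of pairs (walk, `s` sites)) is at
most (number of walks of length `≤ N + Λ s`) `· C(B₀, s) · ((2R+1)^{d+2})^s · (2m+1)^s ·
(Σ_{n ≤ 2m} c_n)^s`. [cite: MadrasSlade1993, Lemma 7.2.6 (proof), (7.2.19)–(7.2.21)] -/
theorem sum_choose_le_of_codes (T : Finset (ℕ → Site (d + 2))) (M : (ℕ → Site (d + 2)) → Finset ℕ)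
    (hT : ∀ ω ∈ T, ValidSet m R N ω (M ω))
    (h1 : ∀ ω ∈ T, ∀ J ⊆ M ω, J.card = s → ∀ l ∈ J, mtimeOf ρ N ω J l ∈ mkT (PhiJ ρ N ω J))
    (h2 : ∀ ω ∈ T, ∀ J ⊆ M ω, J.card = s → (mkT (PhiJ ρ N ω J)).card ≤ B₀) (hR : 0 ≤ R) :
    ∑ ω ∈ T, (M ω).card.choose s ≤
      (∑ n ∈ Finset.range (N + Λ * s + 1), count (d + 2) n) * B₀.choose s *
        ((2 * R.toNat + 1) ^ (d + 2)) ^ s * (2 * m + 1) ^ s * (∑ n ∈ Finset.range (2 * m + 1), count (d + 2) n) ^ s := by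
  classical
  set P : Finset (Σ _ : ℕ → Site (d + 2), Finset ℕ) := T.sigma fun ω => (M ω).powersetCard s with hPdef
  have hP : P.card = ∑ ω ∈ T, (M ω).card.choose s := by
    simp [hPdef, Finset.card_sigma, Finset.card_powersetCard]
  rw [← hP]
  have hmem : ∀ p ∈ P, p.1 ∈ T ∧ p.2 ⊆ M p.1 ∧ p.2.card = s := fun p hp => by
    rw [hPdef, Finset.mem_sigma, Finset.mem_powersetCard] at hp
    exact ⟨hp.1, hp.2.1, hp.2.2⟩
  refine (Finset.card_le_card_of_injOn (fun p => cubeCode ρ N s p.1 p.2) (fun p hp => ?_) ?_).trans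
    (card_codeTarget mkT (N + Λ * s) B₀ s m R.toNat)
  · obtain ⟨hω, hJ, hs⟩ := hmem p hp
    exact cubeCode_mem_codeTarget mkT ρ N s B₀ ((hT _ hω).subset hJ) hs (h1 _ hω _ hJ hs) (h2 _ hω _ hJ hs) hR
  · intro p hp p' hp' he
    obtain ⟨hω, hJ, hs⟩ := hmem p hp
    obtain ⟨hω', hJ', hs'⟩ := hmem p' hp'
    obtain ⟨e1, e2⟩ := cubeCode_inj (ρ := ρ) ((hT _ hω).subset hJ) ((hT _ hω').subset hJ') hs hs' he
    obtain ⟨ω, J⟩ := p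
    obtain ⟨ω', J'⟩ := p'
    simp only at e1 e2
    subst e1
    subst e2
    rfl

end Counting

end Literature.Probability.RandomPlanarGeometry.SAW.Zd
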